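import Summits.AtomisticToContinuum.FouriersLaw.Theses.OddSectorIrreversibility

/-!
# `OddSectorIrreversibility.Assembly` — PROVED

Route `AtomisticToContinuum/FouriersLaw/OddSectorIrreversibility`, assembly item
`stmt-AtomisticToContinuum-15161` (`Assembly`, route rev 17 — the crux-only chain):

  `WitnessGlue → TapLeakBound → ConeScaleCorrector → SubBallisticWindow → NessUnique →
   FiniteResponseOfUnique → BoundedResponseConverges → FouriersLaw`.

The route file carries the planner-authored, sorry-free D-0027 §2.1 deciding theorem
`Summit.AtomisticToContinuum.FouriersLaw.Theses.OddSectorIrreversibility.closes`, whose type is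
literally the body of `Assembly`; this file records the item-closing theorem whose type is the route
decl `Assembly` by name.  For the mathematics (`WitnessGlue` — the transport-witness theorem
`TapLeakBound → ConeScaleCorrector → SubBallisticWindow → BoundedResponse` — turns the three
`N`-uniform cruxes P/E1/E2 into length-uniform bounded response along every steady-state family;
clause (i) of `FouriersLawFor` from the in-tree theorem `pinnedChain_exists_isSteadyState` plus
`NessUnique`; the canonical steady-state family by choice; `D₀` from `FiniteResponseOfUnique`;
bounded ⇒ convergent-positive by `BoundedResponseConverges`; `κ` := the limit, other families agreeing
for `|δ| < 2T` by uniqueness) see the docstring of `closes` in the route file.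
No named-fact hypotheses: the theorem is unconditional (its axioms are those of `closes`:
`propext`, `Classical.choice`, `Quot.sound`).

History.  The same theorem text closed the earlier renderings of this assembly — `stmt-14068`
(rev ≤ 10, ten-hypothesis chain with `CorrectorTheory`, `ClosedConeSensitivity`, `GibbsSteadyState`)
and `stmt-15095` (rev 11) — because its statement is the route decl `Assembly` *by name* and its proof
is `closes` *by name*: whenever the planner re-renders `Assembly` as the verbatim type of the current
`closes`, this file re-elaborates unchanged.  Only the docstrings were refreshed for rev 17.
-/

namespace Summit.AtomisticToContinuum.FouriersLaw.Theorems

/-- Settles `stmt-AtomisticToContinuum-15161` (assembly of route `OddSectorIrreversibility`,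
rev 17): the transport-witness glue `WitnessGlue`, the `N`-uniform tap-leak budget `TapLeakBound`
(P), the true-scale cruxes `ConeScaleCorrector` (E1) and `SubBallisticWindow` (E2), weak
steady-state uniqueness `NessUnique`, existence of the finite-`N` response limits
`FiniteResponseOfUnique` and the limit slot `BoundedResponseConverges` imply the sub-problem
statement `FouriersLaw`.  Proof: the route's deciding theorem `closes` (after unfolding `Assembly`).
[folklore] -/
theorem oddSectorIrreversibility_assembly_proof :
    Summit.AtomisticToContinuum.FouriersLaw.Theses.OddSectorIrreversibility.Assembly := by
  unfold Summit.AtomisticToContinuum.FouriersLaw.Theses.OddSectorIrreversibility.Assembly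
  exact Summit.AtomisticToContinuum.FouriersLaw.Theses.OddSectorIrreversibility.closes

end Summit.AtomisticToContinuum.FouriersLaw.Theorems
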